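import Summits.QuantumFields.QCD.Theses.SpectralDefectExtinction
import Summits.QuantumFields.QCD.Theorems.ChiralDescent.Negative.FlavourGuard
import Literature.MathematicalPhysics.QuantumFieldTheory.QCDGoldstoneBound

/-!
# Disproof of `ChiralDescent` — findings (cdisprove gen 1 / cycle 1; rc 0, 0 sorry, std axioms)

Crux `stmt-QuantumFields-17527`, decl
`Summit.QuantumFields.QCD.Theses.SpectralDefectExtinction.ChiralDescent`
(`= ∀ N_f ∈ {2,3}, Threshold N_f → QCDOf N_f`, `chiralDescent_iff`, `Iff.rfl`), where
`Threshold N_f := ∃ reg, reg.HasMassScaling ∧ ∃ M₁ ≥ 0, BodyAbove reg M₁` is the conclusion of the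
bridge `ExtinctionBuildsQCD` / the antecedent of the proved support `ThresholdForm`, and
`QCDOf N_f = ∃ reg, reg.HasMassScaling ∧ reg.IsChiralAtZero ∧ BodyAbove reg 0` (`qcdOf_iff`, `Iff.rfl`).

## VERDICT (cycle 1): RESISTS — no kill is possible inside the tree, and WHY (Lean-certified below)

* §1 `not_chiralDescent_iff`: `¬ ChiralDescent ↔ ∃ N_f ∈ {2,3}, Threshold N_f ∧ ¬ QCDOf N_f`.
  A refutation must (a) CONSTRUCT threshold massive `N_f = 2` or `3` QCD (OS limit with `IsQCDAlong`,
  non-Gaussian glue, dynamical quarks, both gaps: the open content of cruxes #2–#6 of the route —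
  `threshold_forces_construction`: the only tree inhabitant of `IsQCDFor` is the vacuum, which the
  non-triviality clause excludes) AND (b) DISPROVE the summit conjunct `QCDOf N_f`.
  Conversely `chiralDescent_of_qcd` (`QCD → crux`) and `chiralDescent_of_not_threshold`
  (no threshold theory → crux vacuously): the crux is false ONLY in the window
  "threshold QCD exists but chiral QCD does not".
* §1 `not_chiralDescent_iff_exotic` (the window, made physical by the chirality dichotomy):
  `¬ ChiralDescent ↔ ∃ N_f ∈ {2,3}, Threshold N_f ∧ (EVERY mass-scaling regularisation carrying the
  body at all positive tuples is UNIFORMLY lattice-gapped above 0)` — an exotic uniformly gapped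
  light-quark regime along every all-mass trajectory. That second conjunct is verbatim the technique
  class `mass-uniform-gap` of the catalogued barrier `Literature.Barriers.QuantumFields.AnomalyMatching`
  ("mass-blind gap mechanisms whose bound Δ does not degrade as m → 0⁺" — BARRED: for `N_f = 2` the
  mixed `SU(2)_L²·U(1)_B` anomaly still forces gaplessness (pions OR massless nucleons, 't Hooft's
  exception is gapless either way), for `N_f = 3` the index obstruction; Goldstone/KRS on the χSB branch).
  Kill criterion (vi) of the route is therefore barrier-blocked at the physics level; the only printed
  loophole is scope caveat (d) of that barrier (discontinuity of the spectrum at `m = 0⁺`), for which no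
  mechanism is known. No counterexample family of the area applies.
* §2 DECORATION: `0 ≤ M₁` in the antecedent is idle (`threshold_iff_noSign`); `BodyAbove`/`UniformGapAbove`
  are monotone in the threshold. Every OTHER antecedent clause also occurs in the conclusion, so dropping
  it STRENGTHENS the crux (no `_false_without_` lemma can exist short of a construction) — except the
  flavour guard, which IS load-bearing: landed `Negative/FlavourGuard.lean`
  (`chiralDescent_false_without_guard_of`, `not_qcdOf_zero`; re-exported in §4).
* §3 THE DATA-LEVEL DESCENTS ARE EXHAUSTED (any proof must add light-quark physics):
  `not_isChiralAtZero_of_eventuallyThresholdData` — if the hypothesis' `reg` is uniformly gapped above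
  `M₀`, then NO regularisation each of whose positive-mass schemes has, EVENTUALLY in `k`, the data
  `(β, L, a, m_f)` of some threshold scheme of `reg` read along some `φ → ∞` (this covers the
  `m_crit`-shift by any `M ≥ M₀` — `shift_scheme` —, reindexing/subsequences — `restrict` —, finite
  modifications, and all their compositions: `not_isChiralAtZero_restrict_shift`) is chiral at zero.
  Dual: `isChiralAtZero_of_restrict` — chirality of a reindexing implies chirality of the original at
  the same tuples, so subsequences never CREATE the pin. (Generalises the landed relational obstruction
  `RobustYangMillsHandover.Negative.not_isChiralAtZero_of_uniformGapAbove` — literal equality of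
  schemes; that module is NOT imported here (it sits on `Theses.HeatSlicedQuarks`), the two dichotomy
  facts used are re-proved inline.) Positive dual for provers: `bodyAbove_shift` (the shift carries the body: ThresholdForm).
* §4 NATURAL STRENGTHENINGS: unguarded version false modulo threshold pure gauge (FlavourGuard);
  `KeepThresholdReg` (descend WITHOUT re-zeroing below the threshold: conclude chirality of the
  `M₁`-shift itself) is false under any uniform gap above `M₁` (`not_keepThresholdReg_of_uniformGap`) —
  expected for every honest heavy threshold (gap ≥ min(m_π(M₁), m_glueball) > 0), unprovable here
  (the tree bounds no lattice-QCD correlator above or below). `N_f = 1` analogue: no Goldstone mode at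
  the chiral point (η′ massive), so the pin could only be met at a NON-chiral critical point (the CP /
  Dashen endpoint at negative quark mass, Creutz 2007) — undecidable here either way; the guard
  `N_f ≥ 2` is exactly where "pin = chiral point" is physics (FlavourGuard: `N_f = 0` refutable).
* §5 QUANTIFIER AUDIT of the pin the crux must supply: `IsChiralAtZero` is `∀ ε ∃ m>0 ¬(∀ᶠ k …)` —
  (i) order `∀ε ∃m ∀ᶠk ∀S≥L_k` puts `m` BEFORE `k → ∞`, so the Aoki/Sharpe–Singleton dichotomy
  (first-order branch: `m_π,min = O(a)` at fixed `a`) does not bite (`AokiPhaseDichotomy`, evasion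
  "take a → 0"); (ii) `S` is free above `L_k`, so a pion lighter than `ε` in physical units violates the
  rate-`ε` bound at large `n ≤ S` for every constant (`QCDScheme.not_hasLatticeMassGap_of_frequently_slow_decay`);
  (iii) the pin is one-sided ("some positive tuple is light") but together with `BodyAbove reg 0` it
  pins the offset from both sides (`gap_lt_of_isChiralAtZero`, FlavourGuard); (iv) it is only
  `∃ᶠ k`-strong, not hereditary to subsequences (`QCDGoldstoneBound` header) — irrelevant for a
  refutation, relevant for provers taking diagonal subsequences (use `HasGoldstoneBound`).

## ATTEMPTS LOG (cycle 1) — all dead, reasons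
1. trivial/vacuous: `simp`/`aesop` fail on the crux (W.lean); antecedent not junk-inhabitable
   (`threshold_forces_construction`); conclusion not junk-refutable (would be `¬QCD`).
2. degenerate `N_f`: `N_f = 0` refutes the UNGUARDED crux only modulo pure gauge (landed); `N_f = 1` undecidable here.
3. re-indexing / shift / dilation tricks to manufacture the pin from threshold data: all provably
   inherit uniform gaps (§3); dilation `a ↦ c a, Z_m ↦ c Z_m` keeps bare data but rescales `IsQCDAlong`'s
   test functions, so it is not even body-preserving.
4. "blow-up chirality" (sign-singular twisted functional, sibling `ChiralGluonicCompletion` §5): cannot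
   coexist with the body's gap at the same tuple (`bounded_of_hasLatticeMassGap` there) — no help to a
   descent, no harm to the crux.
5. literature for an exotic uniformly gapped massless `N_f = 2,3` phase ("symmetric mass generation"):
   requires vanishing 't Hooft anomalies — false for fundamental `SU(3)` quarks; barrier catalogue concurs.
-/

noncomputable section

namespace Summit.QuantumFields.QCD.Cruxes.ChiralDescent.Disproof

open Filter
open Literature.MathematicalPhysics.QuantumFieldTheory
open Summit.QuantumFields.QCD.Theses.SpectralDefectExtinction
open Summit.QuantumFields.QCD.Theorems

variable {Nf : ℕ}

/-! ## §0 The crux, clause by clause (definitional packaging) -/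

/-- The per-mass body shared by the antecedent and by `QCDOf` (verbatim). [folklore] -/
def BodyAt (reg : QCDRegularisation Nf) (m : Fin Nf → ℝ) : Prop :=
  ∃ (z shift : QCDField Nf → ℕ → ℝ) (T : OSData (QCDField Nf) 4),
    IsQCDAlong (reg.scheme m z shift) T ∧ T.IsNontrivial QCDField.glue ∧
      T.IsNonGaussian QCDField.glue ∧
        (∀ f g : Fin Nf, f ≠ g → T.IsNontrivial (QCDField.pseudoRe f g)) ∧
          ∃ Δ > 0, T.HasMassGap Δ ∧ (reg.scheme m z shift).HasLatticeMassGap Δ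

/-- The body at every tuple with all components `> μ`. [folklore] -/
def BodyAbove (reg : QCDRegularisation Nf) (μ : ℝ) : Prop :=
  ∀ m : Fin Nf → ℝ, (∀ f, μ < m f) → BodyAt reg m

/-- ONE lattice rate `ε > 0` at every tuple with all components `> μ`. [folklore] -/
def UniformGapAbove (reg : QCDRegularisation Nf) (μ : ℝ) : Prop :=
  ∃ ε > (0 : ℝ), ∀ m : Fin Nf → ℝ, (∀ f, μ < m f) → (reg.scheme m 0 0).HasLatticeMassGap ε

variable (Nf) in
/-- The antecedent of the crux: massive QCD above an unpinned threshold along one mass-scaling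
regularisation (= conclusion of `ExtinctionBuildsQCD`, antecedent of `ThresholdForm`). [folklore] -/
def Threshold : Prop :=
  ∃ reg : QCDRegularisation Nf, reg.HasMassScaling ∧ ∃ M₁ : ℝ, 0 ≤ M₁ ∧ BodyAbove reg M₁

/-- **The crux is, definitionally, `∀ N_f ∈ {2,3}, Threshold N_f → QCDOf N_f`.** [folklore] -/
theorem chiralDescent_iff :
    ChiralDescent ↔ ∀ Nf : ℕ, (Nf = 2 ∨ Nf = 3) → Threshold Nf → QCDOf Nf := Iff.rfl

/-- The re-typed conjunct, definitionally: mass scaling, the pin, the body at ALL positive tuples. [folklore] -/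
theorem qcdOf_iff :
    QCDOf Nf ↔ ∃ reg : QCDRegularisation Nf, reg.HasMassScaling ∧ reg.IsChiralAtZero ∧ BodyAbove reg 0 :=
  Iff.rfl

/-! ## §1 The refutation window -/

/-- The conjunct implies the antecedent (threshold `M₁ = 0`): `Threshold` is the WEAKER statement. [folklore] -/
theorem threshold_of_qcdOf (h : QCDOf Nf) : Threshold Nf := by
  obtain ⟨reg, hMS, -, hB⟩ := h
  exact ⟨reg, hMS, 0, le_rfl, hB⟩

/-- `QCD` proves the crux (conclusion true). [folklore] -/
theorem chiralDescent_of_qcd (h : QCD) : ChiralDescent := by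
  intro Nf hNf _
  rcases hNf with rfl | rfl
  exacts [h.1, h.2]

/-- No threshold theory at `N_f = 2, 3` proves the crux (antecedent false). [folklore] -/
theorem chiralDescent_of_not_threshold (h : ∀ Nf : ℕ, (Nf = 2 ∨ Nf = 3) → ¬ Threshold Nf) :
    ChiralDescent :=
  fun Nf hNf hT => absurd hT (h Nf hNf)

/-- **The window.** The crux fails iff, at `N_f = 2` or `3`, threshold QCD exists and the re-typed
conjunct fails: a refutation needs a CONSTRUCTION of threshold QCD and a DISPROOF of `QCDOf N_f`. [folklore] -/
theorem not_chiralDescent_iff :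
    ¬ ChiralDescent ↔ ∃ Nf : ℕ, (Nf = 2 ∨ Nf = 3) ∧ Threshold Nf ∧ ¬ QCDOf Nf := by
  constructor
  · intro h
    by_contra hne
    push Not at hne
    exact h hne
  · rintro ⟨Nf, hNf, hT, hQ⟩ h
    exact hQ (h Nf hNf hT)

/-- **`¬ QCDOf` through the chirality dichotomy**: the conjunct fails iff EVERY mass-scaling
regularisation carrying the body at all positive tuples is uniformly lattice-gapped above `0`. [folklore] -/
theorem not_qcdOf_iff_uniformGap :
    ¬ QCDOf Nf ↔ ∀ reg : QCDRegularisation Nf, reg.HasMassScaling → BodyAbove reg 0 →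
      UniformGapAbove reg 0 := by
  constructor
  · intro h reg hMS hB
    by_contra hU
    refine h ⟨reg, hMS, ?_, hB⟩
    intro ε hε
    by_contra hno
    push Not at hno
    exact hU ⟨ε, hε, hno⟩
  · rintro h ⟨reg, hMS, hχ, hB⟩
    obtain ⟨ε, hε, hgap⟩ := h reg hMS hB
    obtain ⟨m, hm, hno⟩ := hχ ε hε
    exact hno (hgap m hm)

/-- **The exotic-gap form of the window**: the crux fails iff threshold QCD exists at `N_f = 2` or `3`
while every all-positive-mass regularisation there is UNIFORMLY gapped — the technique class
`mass-uniform-gap` of `Literature.Barriers.QuantumFields.AnomalyMatching` (barred). [folklore] -/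
theorem not_chiralDescent_iff_exotic :
    ¬ ChiralDescent ↔ ∃ Nf : ℕ, (Nf = 2 ∨ Nf = 3) ∧ Threshold Nf ∧
      ∀ reg : QCDRegularisation Nf, reg.HasMassScaling → BodyAbove reg 0 → UniformGapAbove reg 0 := by
  simp only [not_chiralDescent_iff, not_qcdOf_iff_uniformGap]

/-- **The antecedent is not junk-inhabitable**: it forces OS data that are "QCD" in the placeholder
sense AND non-Gaussian in the glue — whereas the only tree inhabitant of `IsQCDFor` is the vacuum
(`isQCDFor_vacuum`), which is neither non-trivial nor non-Gaussian (`OSData.not_isNonGaussian_vacuum`).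
So `Threshold N_f` is constructive content (the route's cruxes #2–#6), not a typing accident. [folklore] -/
theorem threshold_forces_construction (h : Threshold Nf) :
    ∃ T : OSData (QCDField Nf) 4, IsQCDFor Nf T ∧ T.IsNontrivial QCDField.glue ∧
      T.IsNonGaussian QCDField.glue ∧ T ≠ OSData.vacuum (QCDField Nf) 4 := by
  obtain ⟨reg, -, M₁, -, hB⟩ := h
  obtain ⟨z, shift, T, hQ, hNT, hNG, -, -⟩ := hB (fun _ => M₁ + 1) (fun _ => by linarith)
  refine ⟨T, ⟨_, hQ⟩, hNT, hNG, ?_⟩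
  rintro rfl
  exact OSData.not_isNonGaussian_vacuum _ hNG

/-! ## §2 Decorations and monotonicity in the threshold -/

/-- The body above a threshold is the body above every larger threshold. [folklore] -/
theorem bodyAbove_mono (reg : QCDRegularisation Nf) {μ μ' : ℝ} (hle : μ ≤ μ') (h : BodyAbove reg μ) :
    BodyAbove reg μ' :=
  fun m hm => h m fun f => lt_of_le_of_lt hle (hm f)

/-- A uniform gap above a threshold is one above every larger threshold. [folklore] -/
theorem uniformGapAbove_mono (reg : QCDRegularisation Nf) {μ μ' : ℝ} (hle : μ ≤ μ')
    (h : UniformGapAbove reg μ) : UniformGapAbove reg μ' := by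
  obtain ⟨ε, hε, hg⟩ := h
  exact ⟨ε, hε, fun m hm => hg m fun f => lt_of_le_of_lt hle (hm f)⟩

/-- **`0 ≤ M₁` is idle**: the antecedent with an unsigned threshold is the same proposition
(replace `M₁` by `max M₁ 0`). Information for the prover: the sign is decoration. [folklore] -/
theorem threshold_iff_noSign :
    Threshold Nf ↔ ∃ reg : QCDRegularisation Nf, reg.HasMassScaling ∧ ∃ M₁ : ℝ, BodyAbove reg M₁ := by
  constructor
  · rintro ⟨reg, hMS, M₁, -, hB⟩
    exact ⟨reg, hMS, M₁, hB⟩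
  · rintro ⟨reg, hMS, M₁, hB⟩
    exact ⟨reg, hMS, max M₁ 0, le_max_right _ _, bodyAbove_mono reg (le_max_left _ _) hB⟩

/-- Chirality unfolded against `UniformGapAbove`: `reg` is chiral at zero iff it is NOT uniformly
gapped above `0` (the dichotomy of `ChiralityObstruction`, in this file's vocabulary). [folklore] -/
theorem isChiralAtZero_iff_not_uniformGapAbove (reg : QCDRegularisation Nf) :
    reg.IsChiralAtZero ↔ ¬ UniformGapAbove reg 0 := by
  constructor
  · rintro hχ ⟨ε, hε, hgap⟩
    obtain ⟨m, hm, hno⟩ := hχ ε hε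
    exact hno (hgap m hm)
  · intro hU ε hε
    by_contra hno
    push Not at hno
    exact hU ⟨ε, hε, hno⟩

/-! ## §3 Data-level descents are exhausted: shift, reindex, eventual equality -/

/-- The `m_crit`-shift by `M` (the ThresholdForm move): bare trajectories of `m` become those of `M + m`. [folklore] -/
def shift (reg : QCDRegularisation Nf) (M : ℝ) : QCDRegularisation Nf :=
  { reg with mcrit := fun k => reg.mcrit k + reg.a k * M / reg.Zm k }

/-- The shifted scheme at `m` IS the original scheme at `M + m`. [folklore] -/
theorem shift_scheme (reg : QCDRegularisation Nf) (M : ℝ) (m : Fin Nf → ℝ)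
    (z s : QCDField Nf → ℕ → ℝ) :
    (shift reg M).scheme m z s = reg.scheme (fun f => M + m f) z s := by
  simp only [QCDRegularisation.scheme, shift, QCDScheme.mk.injEq, true_and, and_true]
  funext f k
  ring

/-- The shift keeps mass scaling (which never reads `m_crit`). [folklore] -/
theorem hasMassScaling_shift_iff (reg : QCDRegularisation Nf) (M : ℝ) :
    (shift reg M).HasMassScaling ↔ reg.HasMassScaling := Iff.rfl

/-- **Positive dual (ThresholdForm bookkeeping)**: the shift by `M` carries the body above `μ + M`... read
downwards: `BodyAbove reg (M + μ) → BodyAbove (shift reg M) μ`. [folklore] -/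
theorem bodyAbove_shift (reg : QCDRegularisation Nf) (M μ : ℝ) (h : BodyAbove reg (M + μ)) :
    BodyAbove (shift reg M) μ := by
  intro m hm
  obtain ⟨z, s, T, hQ, hNT, hNG, hP, Δ, hΔ, hG, hL⟩ := h (fun f => M + m f) (fun f => by linarith [hm f])
  refine ⟨z, s, T, ?_, hNT, hNG, hP, Δ, hΔ, hG, ?_⟩
  · rwa [shift_scheme]
  · rwa [shift_scheme]

/-- Uniform gaps move with the shift: gapped above `M + μ` ⇒ the `M`-shift is gapped above `μ`. [folklore] -/
theorem uniformGapAbove_shift (reg : QCDRegularisation Nf) (M μ : ℝ) (h : UniformGapAbove reg (M + μ)) :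
    UniformGapAbove (shift reg M) μ := by
  obtain ⟨ε, hε, hg⟩ := h
  refine ⟨ε, hε, fun m hm => ?_⟩
  rw [shift_scheme]
  exact hg _ fun f => by linarith [hm f]

/-- **Transfer of the lattice gap along eventually-equal reindexed data.** If `φ → ∞` and, eventually
in `k`, the scheme `sch'` at step `k` has the coupling, volume, spacing and bare masses of `sch` at step
`φ k`, then a uniform lattice gap of `sch` is one of `sch'` (same rate, same constants). The clause reads
nothing else. [folklore] -/
theorem hasLatticeMassGap_of_eventually_comp {sch sch' : QCDScheme Nf} {φ : ℕ → ℕ}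
    (hφ : Tendsto φ atTop atTop)
    (hdata : ∀ᶠ k in atTop, sch'.β k = sch.β (φ k) ∧ sch'.L k = sch.L (φ k) ∧ sch'.a k = sch.a (φ k) ∧
      ∀ f, sch'.mq f k = sch.mq f (φ k))
    {Δ : ℝ} (h : sch.HasLatticeMassGap Δ) : sch'.HasLatticeMassGap Δ := by
  intro R R' A B
  obtain ⟨C, hC⟩ := h R R' A B
  refine ⟨C, ?_⟩
  filter_upwards [hφ.eventually hC, hdata] with k hk hd S hS n hn
  obtain ⟨hβ, hL, ha, hmq⟩ := hd
  have hmq' : (fun fl => sch'.mq fl k) = fun fl => sch.mq fl (φ k) := funext hmq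
  rw [hβ, ha, hmq']
  exact hk S (hL ▸ hS) n hn

/-- The lattice gap passes to every reindexing `reg.restrict φ hφ` (`φ → ∞`; subsequences included). [folklore] -/
theorem hasLatticeMassGap_restrict (reg : QCDRegularisation Nf) (φ : ℕ → ℕ)
    (hφ : Tendsto φ atTop atTop) (m : Fin Nf → ℝ) (z s : QCDField Nf → ℕ → ℝ) {Δ : ℝ}
    (h : (reg.scheme m z s).HasLatticeMassGap Δ) :
    ((reg.restrict φ hφ).scheme m z s).HasLatticeMassGap Δ :=
  hasLatticeMassGap_of_eventually_comp hφ (Eventually.of_forall fun _ => ⟨rfl, rfl, rfl, fun _ => rfl⟩) h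

/-- Uniform gaps are hereditary to reindexings. [folklore] -/
theorem uniformGapAbove_restrict (reg : QCDRegularisation Nf) (φ : ℕ → ℕ)
    (hφ : Tendsto φ atTop atTop) {μ : ℝ} (h : UniformGapAbove reg μ) :
    UniformGapAbove (reg.restrict φ hφ) μ := by
  obtain ⟨ε, hε, hg⟩ := h
  exact ⟨ε, hε, fun m hm => hasLatticeMassGap_restrict reg φ hφ m 0 0 (hg m hm)⟩

/-- **Subsequences never create the pin**: if a reindexing of `reg` is chiral at zero, so is `reg`
(at the same mass tuples). Contrapositive of `hasLatticeMassGap_restrict`. [folklore] -/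
theorem isChiralAtZero_of_restrict (reg : QCDRegularisation Nf) (φ : ℕ → ℕ)
    (hφ : Tendsto φ atTop atTop) (h : (reg.restrict φ hφ).IsChiralAtZero) : reg.IsChiralAtZero := by
  intro ε hε
  obtain ⟨m, hm, hno⟩ := h ε hε
  exact ⟨m, hm, fun hg => hno (hasLatticeMassGap_restrict reg φ hφ m 0 0 hg)⟩

/-- **THE DATA-LEVEL OBSTRUCTION (master form).** Let the hypothesis' regularisation `reg` be uniformly
gapped above `M₀`. Let `reg'` be ANY regularisation such that for every positive tuple `m` there are a
threshold tuple `m''` (all components `> M₀`) and a reindexing `φ → ∞` along which, EVENTUALLY in `k`,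
the scheme `reg'.scheme m 0 0` has the data `(β, L, a, m_f)` of `reg.scheme m'' 0 0`. Then `reg'` is
NOT chiral at zero. Covers: the `m_crit`-shift by any `M ≥ M₀`, subsequences, finite modifications,
`k`-reparametrisations, and all compositions — every regularisation a proof can NAME from threshold
data alone. Hence any proof of the crux must put NEW (light-quark) information below the threshold or
exhibit gap-closing inside the threshold family itself. [folklore] -/
theorem not_isChiralAtZero_of_eventuallyThresholdData (reg reg' : QCDRegularisation Nf) (M₀ : ℝ)
    (hgap : UniformGapAbove reg M₀)
    (hrel : ∀ m : Fin Nf → ℝ, (∀ f, 0 < m f) → ∃ m'' : Fin Nf → ℝ, (∀ f, M₀ < m'' f) ∧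
      ∃ φ : ℕ → ℕ, Tendsto φ atTop atTop ∧ ∀ᶠ k in atTop,
        (reg'.scheme m 0 0).β k = (reg.scheme m'' 0 0).β (φ k) ∧
          (reg'.scheme m 0 0).L k = (reg.scheme m'' 0 0).L (φ k) ∧
            (reg'.scheme m 0 0).a k = (reg.scheme m'' 0 0).a (φ k) ∧
              ∀ f, (reg'.scheme m 0 0).mq f k = (reg.scheme m'' 0 0).mq f (φ k)) :
    ¬ reg'.IsChiralAtZero := by
  obtain ⟨ε, hε, hg⟩ := hgap
  intro hχ
  obtain ⟨m, hm, hno⟩ := hχ ε hε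
  obtain ⟨m'', hm'', φ, hφ, hdata⟩ := hrel m hm
  exact hno (hasLatticeMassGap_of_eventually_comp hφ hdata (hg m'' hm''))

/-- **Corollary: shift-then-reindex is dead under a uniform gap.** For `M ≥ M₀` and any `φ → ∞`, the
regularisation `(shift reg M).restrict φ` is not chiral at zero if `reg` is uniformly gapped above `M₀`. [folklore] -/
theorem not_isChiralAtZero_restrict_shift (reg : QCDRegularisation Nf) {M₀ M : ℝ} (hM : M₀ ≤ M)
    (hgap : UniformGapAbove reg M₀) (φ : ℕ → ℕ) (hφ : Tendsto φ atTop atTop) :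
    ¬ ((shift reg M).restrict φ hφ).IsChiralAtZero := by
  refine not_isChiralAtZero_of_eventuallyThresholdData reg _ M₀ hgap fun m hm => ?_
  refine ⟨fun f => M + m f, fun f => by linarith [hm f], φ, hφ, Eventually.of_forall fun k => ?_⟩
  refine ⟨rfl, rfl, rfl, fun f => ?_⟩
  simp only [QCDRegularisation.restrict_scheme_mq, shift_scheme]

/-- The plain shift (no reindexing), for the record: under a uniform gap above `M₀`, no shift by
`M ≥ M₀` is chiral at zero (cf. the landed `not_isChiralAtZero_mcrit_shift_of_uniformGapAbove`). [folklore] -/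
theorem not_isChiralAtZero_shift (reg : QCDRegularisation Nf) {M₀ M : ℝ} (hM : M₀ ≤ M)
    (hgap : UniformGapAbove reg M₀) : ¬ (shift reg M).IsChiralAtZero := by
  rw [isChiralAtZero_iff_not_uniformGapAbove, not_not]
  refine uniformGapAbove_shift reg M 0 (uniformGapAbove_mono reg ?_ hgap)
  linarith

/-! ## §4 Natural strengthenings -/

/-- **Strengthening S₁ — descend without leaving the threshold family**: from threshold data conclude
that the `M₁`-shift ITSELF is chiral at zero (no light-quark extension). [folklore] -/
def KeepThresholdReg (Nf : ℕ) : Prop :=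
  ∀ reg : QCDRegularisation Nf, reg.HasMassScaling → ∀ M₁ : ℝ, 0 ≤ M₁ → BodyAbove reg M₁ →
    (shift reg M₁).IsChiralAtZero

/-- `S₁` does imply the crux at its flavour number (so it IS a strengthening). [folklore] -/
theorem qcdOf_of_keepThresholdReg (hS : KeepThresholdReg Nf) (hT : Threshold Nf) : QCDOf Nf := by
  obtain ⟨reg, hMS, M₁, hM₁, hB⟩ := hT
  refine ⟨shift reg M₁, (hasMassScaling_shift_iff reg M₁).2 hMS, hS reg hMS M₁ hM₁ hB, ?_⟩
  exact bodyAbove_shift reg M₁ 0 (by simpa using hB)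

/-- **`S₁` is false as soon as ONE threshold witness is uniformly gapped above its threshold** — the
expected situation for every honest heavy threshold `M₁ > μ_χ` (gap `≥ min(m_π(M₁), m_glueball) > 0`).
Unconditional refutation would need that witness: a construction. [folklore] -/
theorem not_keepThresholdReg_of_uniformGap
    (h : ∃ reg : QCDRegularisation Nf, reg.HasMassScaling ∧ ∃ M₁ : ℝ, 0 ≤ M₁ ∧ BodyAbove reg M₁ ∧
      UniformGapAbove reg M₁) :
    ¬ KeepThresholdReg Nf := by
  rintro hS
  obtain ⟨reg, hMS, M₁, hM₁, hB, hU⟩ := h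
  exact not_isChiralAtZero_shift reg le_rfl hU (hS reg hMS M₁ hM₁ hB)

/-- **Strengthening S₂ — drop the flavour guard**: false modulo threshold pure-gauge theory
(re-export of the landed `ChiralDescent.Negative.chiralDescent_false_without_guard_of`, in this file's
vocabulary). [folklore] -/
theorem not_unguarded_of_thresholdPureGauge (h0 : Threshold 0) :
    ¬ (∀ Nf : ℕ, Threshold Nf → QCDOf Nf) :=
  fun h => ChiralDescent.Negative.not_qcdOf_zero (h 0 h0)

/-- At `N_f = 0` the threshold is idle too: `Threshold 0 ↔ BodyAt` at the unique (empty) tuple along a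
mass-scaling regularisation — the Wilson form of pure `SU(3)` Yang–Mills with both gaps. [folklore] -/
theorem threshold_zero_iff :
    Threshold 0 ↔ ∃ reg : QCDRegularisation 0, reg.HasMassScaling ∧ BodyAt reg Fin.elim0 := by
  constructor
  · rintro ⟨reg, hMS, M₁, -, hB⟩
    exact ⟨reg, hMS, hB _ fun f => f.elim0⟩
  · rintro ⟨reg, hMS, hB⟩
    refine ⟨reg, hMS, 0, le_rfl, fun m _ => ?_⟩
    obtain rfl : m = Fin.elim0 := funext fun i => i.elim0
    exact hB

/-! ## §5 What the crux must supply, isolated (the exact re-type delta) -/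

/-- **The crux's NEW content, isolated**: given the crux and threshold data, a mass-scaling
regularisation that is chiral at zero AND carries the body at all positive tuples — by §3 not
obtainable from the threshold data by shift/reindex under a uniform gap, i.e. light-quark QCD plus
chiral gaplessness (`m_π → 0`: Goldstone, or anomaly matching). [folklore] -/
theorem chiralDescent_content (h : ChiralDescent) (hNf : Nf = 2 ∨ Nf = 3) (hT : Threshold Nf) :
    ∃ reg : QCDRegularisation Nf, reg.HasMassScaling ∧ ¬ UniformGapAbove reg 0 ∧ BodyAbove reg 0 := by
  obtain ⟨reg, hMS, hχ, hB⟩ := h Nf hNf hT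
  exact ⟨reg, hMS, (isChiralAtZero_iff_not_uniformGapAbove reg).1 hχ, hB⟩

/-- Conversely, producing such a regularisation from threshold data at `N_f = 2, 3` IS the crux. [folklore] -/
theorem chiralDescent_of_content
    (h : ∀ Nf : ℕ, (Nf = 2 ∨ Nf = 3) → Threshold Nf →
      ∃ reg : QCDRegularisation Nf, reg.HasMassScaling ∧ ¬ UniformGapAbove reg 0 ∧ BodyAbove reg 0) :
    ChiralDescent := by
  intro Nf hNf hT
  obtain ⟨reg, hMS, hU, hB⟩ := h Nf hNf hT
  exact ⟨reg, hMS, (isChiralAtZero_iff_not_uniformGapAbove reg).2 hU, hB⟩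

end Summit.QuantumFields.QCD.Cruxes.ChiralDescent.Disproof

end
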